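import Summits.HodgeConjecture.HodgeConjecture.Theorems.F0P3cDyRamFourFramePieces      -- ★ DEFS LEAF №3 (p854653): `InLevel`, `NearTransvShell`, `valueSetMod`, `xPlus`, `LabelPlus`
import Literature.NumberTheory.LocalFields.WildQuadraticDatumRefSkewScalar              -- ★ p854720: the reference skew scalar `c` of `xPlus` — skew, `v c = exp(−(d % 2))`, `≠ 0`
import HarnessLib

/-!
# Crux `H413`, line LH4 «(D-RAM) FOUR-FRAME», tier 2 under `U4_Rows` §2 (the unipotent TABLE): SHELL LEMMAS for the explicit pieces of DEFS LEAF №3 —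
# the zero matrix is in every level and never on a near-transvection shell; a square-zero `X` has `X² ∈ ϖ^m M₃(𝒪)` at every level; the reference nilpotent
# `xPlus σ ϖ d = c·E₁₃` squares to `0`, lies on the shell of depth `ℓ₀ = d % 2` at EVERY level, and carries the label `+` by reflexivity

Cell `hodgecm-mathlib` (D-0151), FLOOR 0, crux item H413 = `stmt-HodgeConjecture-24833`, route of record `HCCMUnconditional`; squad F0∕P3c∕LH4, Track A; dealer LH4-plan
(g10) WORD #16 «U4 §2 (table) tier-2 proofs: `stub_U4_table_vanishing` (S), `stub_U4_table_diag_pos` (M)» — taken by LH4-p03 (g11).  THEOREMS ONLY (no `def`, no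
instance, no notation, no `sorry`, default heartbeats); imports = ★ №3 `Theorems/F0P3cDyRamFourFramePieces.lean` + ★ `Literature/…/WildQuadraticDatumRefSkewScalar.lean` +
HarnessLib; lane `--supports stmt-HodgeConjecture-24833 --as helper` (count-neutral).

WHAT IS PROVED (the matrix-level facts behind the table's ZERO entries `f_{T±}(1) = 0`, `f_reg|{1, T±} = 0` and behind the `T₊` DIAGONAL entry; the group-level
wrappers — `wMatrix 1 = 1`, conjugation, the unitary transvection `1 + xPlus` inside `K` — are the next file, once the dealer's `Lines/F0_P3c_DyRamFourFrame_U4_Rows.lean`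
fixes the stub texts):
* §1 `inLevel_zero` (`0 ∈ ϖ^m M₃(𝒪)` for every `m`), `not_nearTransvShell_zero` (the identity's `X = 0` is on NO shell ⇒ `f_{T±}(1) = 0`), `inLevel_mono` (`m′ ≤ m ⇒
  InLevel m X → InLevel m′ X`, `|ϖ| ≤ 1`), `inLevel_of_mul_self_eq_zero` (`X·X = 0 ⇒ InLevel m (X·X)` — every TRANSVECTION has `X² ∈ ϖ^{m*}M₃`, so `f_reg` vanishes on
  the transvection classes), `not_inLevel_mul_self_of_pieceReg`-shape bookkeeping is left to the set-builder (it IS the definition).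
* §2 the reference nilpotent: `xPlus_apply` (entries), `xPlus_mul_xPlus` (`= 0`), `inLevel_xPlus` (`InLevel ϖ (d % 2) (xPlus σ ϖ d)`), `not_inLevel_succ_xPlus`
  (`¬ InLevel ϖ (d % 2 + 1) (xPlus σ ϖ d)` — the `(0,2)` entry has valuation EXACTLY `exp(−(d % 2))`, ★ `v_refSkewScalar`), **`nearTransvShell_xPlus`**
  (`NearTransvShell ϖ (d % 2) m (xPlus σ ϖ d)` for EVERY level `m`), `labelPlus_xPlus` (`LabelPlus σ ϖ d m (xPlus σ ϖ d)`, by `rfl`), `map_xPlus_entry_eq_neg`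
  (the `(0,2)` entry is skew — so `1 + xPlus` is `Φ₃`-unitary, next file).
Hypotheses = conjuncts of the sheet datum `IsRamifiedQuadraticDatum σ ϖ d t` taken one by one (`hσ`, `hvσ`, `hϖ`, `hd`); abstract `[Field K] [Valued K ℤᵐ⁰]`.

HONEST LABEL.  Count-neutral helper; no stub is paid here.  The verdict of record for (D-RAM) stays PRINT [LanglandsShelstad1989 Thm. p. 484 ∕ Rogawski1990 Prop.
4.9.1 (a)] ∕ XL; `HC_CM` is proved only modulo the 7 printed citations (2 remaining: hLiu418 = `stmt-HodgeConjecture-24832`, h413 = `stmt-HodgeConjecture-24833`) until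
rung 0 closes.
-/

noncomputable section

namespace Summit.HodgeConjecture.HodgeConjecture.Cruxes.H413.F0P3cDyRamPiecesShellLemmas

open scoped Matrix
open WithZero
open Summit.HodgeConjecture.HodgeConjecture.Cruxes.H413.F0P3cDyRamFourFramePieces
open Literature.NumberTheory.LocalFields.WildQuadraticDatum

variable {K : Type*} [Field K] [Valued K ℤᵐ⁰]

/-! ## §1  Levels and shells: the zero matrix, monotonicity, square-zero matrices -/

/-- The zero matrix lies in every level `ϖ^m M₃(𝒪)`. -/
theorem inLevel_zero (ϖ : K) (m : ℕ) : InLevel ϖ m (0 : Matrix (Fin 3) (Fin 3) K) := by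
  intro a b
  rw [Matrix.zero_apply, mul_zero, map_zero]
  exact zero_le

/-- **The zero matrix is on NO near-transvection shell** (`NearTransvShell ϖ ℓ m 0` would need `0 ∉ ϖ^{ℓ+1} M₃(𝒪)`): with `X := wMatrix 1 − 1 = 0` this is
`f_{T+}(1) = f_{T−}(1) = 0` of the unipotent table. -/
theorem not_nearTransvShell_zero (ϖ : K) (ℓ m : ℕ) : ¬ NearTransvShell ϖ ℓ m (0 : Matrix (Fin 3) (Fin 3) K) :=
  fun h => h.2.1 (inLevel_zero ϖ (ℓ + 1))

/-- Levels are MONOTONE: `m′ ≤ m`, `X ∈ ϖ^m M₃(𝒪) ⇒ X ∈ ϖ^{m′} M₃(𝒪)` (`|ϖ| ≤ 1`, `ϖ ≠ 0`). -/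
theorem inLevel_mono {ϖ : K} (hϖ1 : Valued.v ϖ ≤ 1) (hϖ0 : ϖ ≠ 0) {m m' : ℕ} (hmm : m' ≤ m) {X : Matrix (Fin 3) (Fin 3) K}
    (h : InLevel ϖ m X) : InLevel ϖ m' X := by
  obtain ⟨k, rfl⟩ := Nat.exists_eq_add_of_le hmm
  intro a b
  have key : (ϖ ^ m')⁻¹ * X a b = ϖ ^ k * ((ϖ ^ (m' + k))⁻¹ * X a b) := by
    rw [pow_add, mul_inv, ← mul_assoc, ← mul_assoc, mul_comm (ϖ ^ k), mul_assoc ((ϖ ^ m')⁻¹), mul_inv_cancel₀ (pow_ne_zero _ hϖ0),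
      mul_one]
  rw [key, map_mul, map_pow]
  exact mul_le_one' (pow_le_one' hϖ1 _) (h a b)

/-- **A square-zero matrix has `X·X` in every level**: `X·X = 0 ⇒ InLevel ϖ m (X·X)` — every TRANSVECTION `u` (`(ι_w u − 1)² = 0`) fails `f_reg`'s clause
`X² ∉ ϖ^{m*} M₃(𝒪)`, so `f_reg` vanishes on the transvection classes (and at `1`). -/
theorem inLevel_of_mul_self_eq_zero (ϖ : K) (m : ℕ) {X : Matrix (Fin 3) (Fin 3) K} (hX : X * X = 0) : InLevel ϖ m (X * X) := by
  rw [hX]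
  exact inLevel_zero ϖ m

/-! ## §2  The reference nilpotent `xPlus σ ϖ d = c·E₁₃` -/

omit [Valued K ℤᵐ⁰] in
/-- The entries of `xPlus`: the `(0,2)` entry is the reference skew scalar `c`, all others vanish. -/
theorem xPlus_apply (σ : K →+* K) (ϖ : K) (d : ℕ) (i j : Fin 3) :
    xPlus σ ϖ d i j = if i = 0 ∧ j = 2 then (ϖ - σ ϖ) * ((ϖ * σ ϖ) ^ ((d - d % 2) / 2))⁻¹ else 0 := by
  rw [xPlus, Matrix.of_apply]

omit [Valued K ℤᵐ⁰] in
/-- **`xPlus` squares to zero** (`E₁₃² = 0`): `1 + xPlus` is unipotent of transvection type. -/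
theorem xPlus_mul_xPlus (σ : K →+* K) (ϖ : K) (d : ℕ) : xPlus σ ϖ d * xPlus σ ϖ d = 0 := by
  ext i j
  simp [Matrix.mul_apply, Fin.sum_univ_three, xPlus_apply]

/-- **`xPlus` lies in the level of its depth `ℓ₀ = d % 2`**: every entry has valuation `≤ exp(−(d % 2))` (the one non-zero entry has exactly that valuation,
★ `v_refSkewScalar`). -/
theorem inLevel_xPlus {σ : K →+* K} (hvσ : ∀ a, Valued.v (σ a) = Valued.v a) {ϖ : K} (hϖ : Valued.v ϖ = exp (-1 : ℤ)) {d : ℕ}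
    (hd : Valued.v (ϖ - σ ϖ) = Valued.v ϖ ^ d) : InLevel ϖ (d % 2) (xPlus σ ϖ d) := by
  intro a b
  rw [xPlus_apply]
  split_ifs with h
  · rw [map_mul, map_inv₀, map_pow, v_varpi_pow hϖ, v_refSkewScalar hvσ hϖ hd, ← exp_neg, ← exp_add, ← exp_zero, exp_le_exp]
    omega
  · rw [mul_zero, map_zero]
    exact zero_le

/-- **`xPlus` is NOT in the next level**: its `(0,2)` entry has valuation exactly `exp(−(d % 2)) > exp(−(d % 2 + 1))`. -/
theorem not_inLevel_succ_xPlus {σ : K →+* K} (hvσ : ∀ a, Valued.v (σ a) = Valued.v a) {ϖ : K} (hϖ : Valued.v ϖ = exp (-1 : ℤ)) {d : ℕ}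
    (hd : Valued.v (ϖ - σ ϖ) = Valued.v ϖ ^ d) : ¬ InLevel ϖ (d % 2 + 1) (xPlus σ ϖ d) := by
  intro h
  have h02 := h 0 2
  rw [xPlus_apply, if_pos ⟨rfl, rfl⟩, map_mul, map_inv₀, map_pow, v_varpi_pow hϖ, v_refSkewScalar hvσ hϖ hd, ← exp_neg, ← exp_add,
    ← exp_zero, exp_le_exp] at h02
  push_cast at h02
  omega

/-- **THE REFERENCE NILPOTENT IS ON THE SHELL OF DEPTH `ℓ₀ = d % 2` AT EVERY LEVEL `m`**: `NearTransvShell ϖ (d % 2) m (xPlus σ ϖ d)` — depth exactly `ℓ₀` (§2) and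
`xPlus² = 0 ∈ ϖ^m M₃(𝒪)` (§1).  With `labelPlus_xPlus` this puts the unitary transvection `1 + xPlus` (in `K`, next file) inside the support of `f_{T+}`: the `T₊`
DIAGONAL entry of the table meets its piece. -/
theorem nearTransvShell_xPlus {σ : K →+* K} (hvσ : ∀ a, Valued.v (σ a) = Valued.v a) {ϖ : K} (hϖ : Valued.v ϖ = exp (-1 : ℤ)) {d : ℕ}
    (hd : Valued.v (ϖ - σ ϖ) = Valued.v ϖ ^ d) (m : ℕ) : NearTransvShell ϖ (d % 2) m (xPlus σ ϖ d) :=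
  ⟨inLevel_xPlus hvσ hϖ hd, not_inLevel_succ_xPlus hvσ hϖ hd, inLevel_of_mul_self_eq_zero ϖ m (xPlus_mul_xPlus σ ϖ d)⟩

/-- The reference nilpotent carries the label `+` (the label IS «same value set as `xPlus`»). -/
theorem labelPlus_xPlus (σ : K →+* K) (ϖ : K) (d m : ℕ) : LabelPlus σ ϖ d m (xPlus σ ϖ d) := rfl

omit [Valued K ℤᵐ⁰] in
/-- The `(0,2)` entry of `xPlus` is SKEW: `σ (xPlus σ ϖ d 0 2) = −xPlus σ ϖ d 0 2` (★ `map_refSkewScalar_eq_neg`) — the unitarity condition `c + σc = 0` of the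
transvection `1 + c·E₁₃` for `Φ₃ = antidiag(1,1,1)`. -/
theorem map_xPlus_entry_eq_neg {σ : K →+* K} (hσ : ∀ x, σ (σ x) = x) (ϖ : K) (d : ℕ) :
    σ (xPlus σ ϖ d 0 2) = -xPlus σ ϖ d 0 2 := by
  rw [xPlus_apply, if_pos ⟨rfl, rfl⟩]
  exact map_refSkewScalar_eq_neg hσ _

end Summit.HodgeConjecture.HodgeConjecture.Cruxes.H413.F0P3cDyRamPiecesShellLemmas

end
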